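import Summits.QuantumFields.YangMills.Theorems.CovariantDischargeDoorThresholdJ0
import HarnessLib

/-!
# Line «sandwich_discharge» on crux `HistoryTailL` (stmt-QuantumFields-19936), stub `stub_sandwichSweepGapCapped` (S′), B6 door —
# THE (η)-SIGNAL LEAF (S7): «EVERY SECOND-ORDER ∕ PROFILE ERROR OF THE SIGNAL CHAIN IS `≤ θ∕64` PAST THE DEPTH THRESHOLD»

Cell `ym3-torus` (YM ladder rung R3 = continuum SU(2) Yang–Mills on the three-torus — a RUNG, NOT the Clay problem: not d = 4, not
infinite volume, not a mass gap); WIDTH helper seat `ym3-torus-px7` gen 8; `--supports stmt-QuantumFields-19936` (helper).  THEOREMS ONLY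
(0 `def`, 0 `sorry`, default heartbeats).  Imports ✓`CovariantDischargeDoorThresholdJ0` (px6 g8; through it ✓`CovariantDischargeDoorExponentRows`).

WHY.  The B6 door skeleton of record (px8 g7, `DOOR-SKELETON-px8g7.lean` v3, HOME `ym3-torus-px8/g7/`) derives the signal inequality
`s·θ∕2 ≤ SIG` from four smallness conjuncts `hS7` (its lines :377–:381), each `≤ θ∕64`, written in the DOOR's letters:
* (1) `√3·(13·βj²)·(L^j)² + Ej`, the reading errors at height `j`, with `βj := ((2d(4L^j+2)+2)²∕4)·θK` (the lasso bound on the one-stroke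
  box) and `Ej := √3·100·(4((d+2)L))^{2j}·βj²`;
* (2) `((L^j)²∕(L^h)²)·(√3·(13·βh²)·(L^h)² + Eh)`, the same at the far height `h = j + m`, weighted by `L^{−2m}`;
* (3) `(√3·θK)·(A_S·(24·(L^j)²·L^h)∕R)`, the (P″) profile error;
* (4) `ηΦ∕3·((A_B + A_B′(2R + 2L^h))·4(L^j)²)`, the bulk (Bianchi-defect) error, `ηΦ := √3(60θK² + 6βKθK)`, `βK := ((2d(2R+2)+2)²∕4)·θK`.
px6 g8's rows bound MAJORANTS of these in FACTOR × `θ` form (✓`reading_row_le'`, ✓`reading_row_far_le'`, ✓`bulk_row_le'`; ✓`profile_error_row_le`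
is (3) on the nose) and ✓`exists_j0_door_nat` makes every factor `≤ ε` past one `j₀`.  THIS FILE is the leaf in between: at `d = 3` the door's
letters are dominated by px6's (`(12L^j+7)² ≤ 175·L^{2j}` once `L^j ≥ 6`, `(6R+7)² ≤ 49R²` once `R ≥ 7`, `13·(L^k)² ≤ 100·(20L)^{2k}`), so with
`ε ≤ 1∕128` the four conjuncts follow.  Everything is PURE REAL ALGEBRA in free symbols with hypotheses; the skeleton instantiates
`θ := θBal(b)(K−j)`, `θK := θBal(b)(K)`, `x := θBal(Λb)(K−j)`, `R := N_R·L^{2j+h}`, `d := (F.P K).d = 3`.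

WHAT IS PROVED (ns `…Theorems.CovariantDischargeDoorSignalRows`).  §1 bridges: `sq_twelve_mul_add_seven_le`, `sq_six_mul_add_seven_le`, the
`ℕ`-cast identities for `βk`∕`βK`∕`4((d+2)L)` at `d = 3`, `beta_le` (`βk ≤ 175·L^{2k}·θK`), `sq_pow_le_twenty_pow`.  §2 the two reading conjuncts
from the FACTOR rows (`reading_conjunct_le`, `reading_far_conjunct_le`), the bulk conjunct (`bulk_conjunct_le`).  §3 ★`signal_rows_le` — the
four conjuncts of `hS7` at once, hypotheses = px6's row hypotheses + `12 ≤ R`, `6 ≤ L^j`, `ε ≤ 1∕128` and the three factor rows `≤ ε`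
(conjuncts 3, 4, 1 of ✓`exists_j0_door_nat`'s `∀ j > j₀` clause).
HONEST SCOPE: real arithmetic; NOTHING here proves the other seven leaves of the door, the capped stub, `HistoryTailL`, or any summit statement;
YM₃ on T³ is rung R3, not Clay. [folklore]
-/

set_option autoImplicit false

noncomputable section

namespace Summit.QuantumFields.YangMills.Theorems.CovariantDischargeDoorSignalRows

open Summit.QuantumFields.YangMills.Theorems.CovariantDischargeDoorExponentRows
open Summit.QuantumFields.YangMills.Theorems.CovariantDischargeDoorThresholdJ0

/-! ## §1 Bridges between the door's letters and the rows' letters -/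

/-- `(12A + 7)² ≤ 175·A²` for `A ≥ 6` (the one-stroke lasso radius `12L^k + 7` against the row's `175·L^{2k}`). [folklore] -/
theorem sq_twelve_mul_add_seven_le {A : ℝ} (hA : 6 ≤ A) : (12 * A + 7) ^ 2 ≤ 175 * A ^ 2 := by
  nlinarith [mul_nonneg (by linarith : (0 : ℝ) ≤ A - 6) (by linarith : (0 : ℝ) ≤ A + 6)]

/-- `(6R + 7)² ≤ 49·R²` for `R ≥ 7` (the pairing-box lasso radius `6R + 7` against the row's `7R`). [folklore] -/
theorem sq_six_mul_add_seven_le {R : ℝ} (hR : 7 ≤ R) : (6 * R + 7) ^ 2 ≤ 49 * R ^ 2 := by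
  nlinarith [mul_nonneg (by linarith : (0 : ℝ) ≤ R - 7) (by linarith : (0 : ℝ) ≤ R + 7)]

/-- The door's lasso prefactor at `d = 3`: `((2·3·(4L^k+2)+2)²∕4 : ℝ) = (12·L^k + 7)²`. [folklore] -/
theorem beta_prefactor_eq (L k : ℕ) :
    (((2 * 3 * (4 * L ^ k + 2) + 2 : ℕ) : ℝ) ^ 2 / 4) = (12 * (L : ℝ) ^ k + 7) ^ 2 := by
  push_cast
  ring

/-- The door's pairing-box prefactor at `d = 3`: `((2·3·(2R+2)+2)²∕4 : ℝ) = (6R + 7)²`. [folklore] -/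
theorem betaK_prefactor_eq (R : ℕ) :
    (((2 * 3 * (2 * R + 2) + 2 : ℕ) : ℝ) ^ 2 / 4) = (6 * (R : ℝ) + 7) ^ 2 := by
  push_cast
  ring

/-- The one-stroke reading constant at `d = 3`: `4·((3+2)·L) = 20·L`. [folklore] -/
theorem four_mul_cast_eq (L : ℕ) : (4 * ((((3 + 2) * L : ℕ) : ℝ))) = 20 * (L : ℝ) := by
  push_cast
  ring

/-- ★ `βk ≤ 175·L^{2k}·θK` at `d = 3` once `L^k ≥ 6` (`θK ≥ 0`). [folklore] -/
theorem beta_le {L k : ℕ} (hLk : (6 : ℝ) ≤ (L : ℝ) ^ k) {θK : ℝ} (hθK0 : 0 ≤ θK) :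
    (((2 * 3 * (4 * L ^ k + 2) + 2 : ℕ) : ℝ) ^ 2 / 4) * θK ≤ 175 * (L : ℝ) ^ (2 * k) * θK := by
  rw [beta_prefactor_eq, show (L : ℝ) ^ (2 * k) = ((L : ℝ) ^ k) ^ 2 by rw [← pow_mul, mul_comm]]
  exact mul_le_mul_of_nonneg_right (sq_twelve_mul_add_seven_le hLk) hθK0

/-- `(L^k)² ≤ (20L)^{2k}`. [folklore] -/
theorem sq_pow_le_twenty_pow (L k : ℕ) : ((L : ℝ) ^ k) ^ 2 ≤ (20 * (L : ℝ)) ^ (2 * k) := by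
  rw [← pow_mul, mul_comm k 2, mul_pow]
  have h1 : (1 : ℝ) ≤ (20 : ℝ) ^ (2 * k) := one_le_pow₀ (by norm_num)
  have h0 : (0 : ℝ) ≤ (L : ℝ) ^ (2 * k) := by positivity
  nlinarith

/-! ## §2 The conjuncts one by one -/

section Conjuncts

variable {L : ℕ} {p₀ θ x θK N_R : ℝ} {j m h : ℕ}

/-- The reading pair at one height `k`, in the door's letters at `d = 3`, is at most TWICE the row's left-hand side
`100√3·(20L)^{2k}·(175L^{2k}θK)²` (`L^k ≥ 6`, `θK ≥ 0`). [folklore] -/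
theorem reading_pair_le_two_mul {k : ℕ} (hLk : (6 : ℝ) ≤ (L : ℝ) ^ k) (hθK0 : 0 ≤ θK) :
    Real.sqrt 3 * (13 * ((((2 * 3 * (4 * L ^ k + 2) + 2 : ℕ) : ℝ) ^ 2 / 4) * θK) ^ 2) * ((L : ℝ) ^ k) ^ 2
        + Real.sqrt 3 * (100 * ((4 * ((((3 + 2) * L : ℕ) : ℝ))) ^ k) ^ 2 * ((((2 * 3 * (4 * L ^ k + 2) + 2 : ℕ) : ℝ) ^ 2 / 4) * θK) ^ 2)
      ≤ 2 * (100 * Real.sqrt 3 * (20 * (L : ℝ)) ^ (2 * k) * (175 * (L : ℝ) ^ (2 * k) * θK) ^ 2) := by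
  have h3 : 0 ≤ Real.sqrt 3 := Real.sqrt_nonneg 3
  have hβ0 : 0 ≤ (((2 * 3 * (4 * L ^ k + 2) + 2 : ℕ) : ℝ) ^ 2 / 4) * θK := by positivity
  have hβ := beta_le hLk hθK0
  -- the square of the door's `β` is below the square of the row's `β`
  have hY : ((((2 * 3 * (4 * L ^ k + 2) + 2 : ℕ) : ℝ) ^ 2 / 4) * θK) ^ 2 ≤ (175 * (L : ℝ) ^ (2 * k) * θK) ^ 2 :=
    pow_le_pow_left₀ hβ0 hβ 2
  have hY0 : 0 ≤ ((((2 * 3 * (4 * L ^ k + 2) + 2 : ℕ) : ℝ) ^ 2 / 4) * θK) ^ 2 := sq_nonneg _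
  have h20 : ((4 * ((((3 + 2) * L : ℕ) : ℝ))) ^ k) ^ 2 = (20 * (L : ℝ)) ^ (2 * k) := by
    rw [four_mul_cast_eq, ← pow_mul, mul_comm k 2]
  rw [h20]
  have hA := sq_pow_le_twenty_pow L k
  have hP0 : 0 ≤ (20 * (L : ℝ)) ^ (2 * k) := by positivity
  -- first term ≤ row LHS, second term ≤ row LHS
  have hYP0 : 0 ≤ (175 * (L : ℝ) ^ (2 * k) * θK) ^ 2 * (20 * (L : ℝ)) ^ (2 * k) := by positivity
  have t1 : Real.sqrt 3 * (13 * ((((2 * 3 * (4 * L ^ k + 2) + 2 : ℕ) : ℝ) ^ 2 / 4) * θK) ^ 2) * ((L : ℝ) ^ k) ^ 2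
      ≤ 100 * Real.sqrt 3 * (20 * (L : ℝ)) ^ (2 * k) * (175 * (L : ℝ) ^ (2 * k) * θK) ^ 2 := by
    have hYA : ((((2 * 3 * (4 * L ^ k + 2) + 2 : ℕ) : ℝ) ^ 2 / 4) * θK) ^ 2 * ((L : ℝ) ^ k) ^ 2
        ≤ (175 * (L : ℝ) ^ (2 * k) * θK) ^ 2 * (20 * (L : ℝ)) ^ (2 * k) := mul_le_mul hY hA (by positivity) (by positivity)
    have h13 := mul_le_mul_of_nonneg_left hYA h3
    calc Real.sqrt 3 * (13 * ((((2 * 3 * (4 * L ^ k + 2) + 2 : ℕ) : ℝ) ^ 2 / 4) * θK) ^ 2) * ((L : ℝ) ^ k) ^ 2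
        = 13 * (Real.sqrt 3 * (((((2 * 3 * (4 * L ^ k + 2) + 2 : ℕ) : ℝ) ^ 2 / 4) * θK) ^ 2 * ((L : ℝ) ^ k) ^ 2)) := by ring
      _ ≤ 13 * (Real.sqrt 3 * ((175 * (L : ℝ) ^ (2 * k) * θK) ^ 2 * (20 * (L : ℝ)) ^ (2 * k))) :=
          mul_le_mul_of_nonneg_left h13 (by norm_num)
      _ ≤ 100 * (Real.sqrt 3 * ((175 * (L : ℝ) ^ (2 * k) * θK) ^ 2 * (20 * (L : ℝ)) ^ (2 * k))) :=
          mul_le_mul_of_nonneg_right (by norm_num) (mul_nonneg h3 hYP0)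
      _ = 100 * Real.sqrt 3 * (20 * (L : ℝ)) ^ (2 * k) * (175 * (L : ℝ) ^ (2 * k) * θK) ^ 2 := by ring
  have t2 : Real.sqrt 3 * (100 * (20 * (L : ℝ)) ^ (2 * k) * ((((2 * 3 * (4 * L ^ k + 2) + 2 : ℕ) : ℝ) ^ 2 / 4) * θK) ^ 2)
      ≤ 100 * Real.sqrt 3 * (20 * (L : ℝ)) ^ (2 * k) * (175 * (L : ℝ) ^ (2 * k) * θK) ^ 2 := by
    have hPY : (20 * (L : ℝ)) ^ (2 * k) * ((((2 * 3 * (4 * L ^ k + 2) + 2 : ℕ) : ℝ) ^ 2 / 4) * θK) ^ 2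
        ≤ (20 * (L : ℝ)) ^ (2 * k) * (175 * (L : ℝ) ^ (2 * k) * θK) ^ 2 := mul_le_mul_of_nonneg_left hY hP0
    have h100 := mul_le_mul_of_nonneg_left hPY (by positivity : 0 ≤ 100 * Real.sqrt 3)
    calc Real.sqrt 3 * (100 * (20 * (L : ℝ)) ^ (2 * k) * ((((2 * 3 * (4 * L ^ k + 2) + 2 : ℕ) : ℝ) ^ 2 / 4) * θK) ^ 2)
        = 100 * Real.sqrt 3 * ((20 * (L : ℝ)) ^ (2 * k) * ((((2 * 3 * (4 * L ^ k + 2) + 2 : ℕ) : ℝ) ^ 2 / 4) * θK) ^ 2) := by ring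
      _ ≤ 100 * Real.sqrt 3 * ((20 * (L : ℝ)) ^ (2 * k) * (175 * (L : ℝ) ^ (2 * k) * θK) ^ 2) := h100
      _ = 100 * Real.sqrt 3 * (20 * (L : ℝ)) ^ (2 * k) * (175 * (L : ℝ) ^ (2 * k) * θK) ^ 2 := by ring
  linarith

/-- ★ **CONJUNCT (1)** — the reading errors at height `j` are `≤ θ∕64` once the reading FACTOR is `≤ ε ≤ 1∕128`. [folklore] -/
theorem reading_conjunct_le (hL : 1 ≤ L) (hLj : (6 : ℝ) ≤ (L : ℝ) ^ j) (hθ : 0 ≤ θ) (hθx : θ ≤ x) (hθK0 : 0 ≤ θK)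
    (hθK : θK ≤ (2 : ℝ) ^ p₀ * Real.sqrt ((L : ℝ)⁻¹) ^ j * θ) (hx : x ≤ (151 * (L : ℝ) ^ 2 * ((L : ℝ)⁻¹) ^ 19) ^ j)
    {ε : ℝ} (hε : ε ≤ 1 / 128)
    (hread : 3062500 * Real.sqrt 3 * ((4 : ℝ) ^ p₀ * 1) * (60400 : ℝ) ^ j / (L : ℝ) ^ (12 * j) ≤ ε) :
    Real.sqrt 3 * (13 * ((((2 * 3 * (4 * L ^ j + 2) + 2 : ℕ) : ℝ) ^ 2 / 4) * θK) ^ 2) * ((L : ℝ) ^ j) ^ 2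
        + Real.sqrt 3 * (100 * ((4 * ((((3 + 2) * L : ℕ) : ℝ))) ^ j) ^ 2 * ((((2 * 3 * (4 * L ^ j + 2) + 2 : ℕ) : ℝ) ^ 2 / 4) * θK) ^ 2)
      ≤ θ / 64 := by
  have hpair := reading_pair_le_two_mul (L := L) hLj hθK0
  have hrow := reading_row_le' hL hθ hθx hθK0 hθK hx
  have hfac : 3062500 * Real.sqrt 3 * ((4 : ℝ) ^ p₀ * 1) * (60400 : ℝ) ^ j / (L : ℝ) ^ (12 * j) * θ ≤ ε * θ :=
    mul_le_mul_of_nonneg_right hread hθ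
  have hεθ : ε * θ ≤ 1 / 128 * θ := mul_le_mul_of_nonneg_right hε hθ
  linarith

/-- ★ **CONJUNCT (2)** — the reading errors at the far height `h = j + m`, weighted by `(L^j)²∕(L^h)² = L^{−2m}`, are `≤ θ∕64` once the
far reading FACTOR is `≤ ε ≤ 1∕128`. [folklore] -/
theorem reading_far_conjunct_le (hL : 1 ≤ L) (hh : h = j + m) (hLj : (6 : ℝ) ≤ (L : ℝ) ^ j) (hθ : 0 ≤ θ) (hθx : θ ≤ x)
    (hθK0 : 0 ≤ θK) (hθK : θK ≤ (2 : ℝ) ^ p₀ * Real.sqrt ((L : ℝ)⁻¹) ^ j * θ) (hx : x ≤ (151 * (L : ℝ) ^ 2 * ((L : ℝ)⁻¹) ^ 19) ^ j)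
    {ε : ℝ} (hε : ε ≤ 1 / 128)
    (hfar : 3062500 * Real.sqrt 3 * ((4 : ℝ) ^ p₀ * (400 : ℝ) ^ m * (L : ℝ) ^ (4 * m)) * (60400 : ℝ) ^ j / (L : ℝ) ^ (12 * j) ≤ ε) :
    (((L : ℝ) ^ j) ^ 2 / ((L : ℝ) ^ h) ^ 2) *
        (Real.sqrt 3 * (13 * ((((2 * 3 * (4 * L ^ h + 2) + 2 : ℕ) : ℝ) ^ 2 / 4) * θK) ^ 2) * ((L : ℝ) ^ h) ^ 2
          + Real.sqrt 3 * (100 * ((4 * ((((3 + 2) * L : ℕ) : ℝ))) ^ h) ^ 2 * ((((2 * 3 * (4 * L ^ h + 2) + 2 : ℕ) : ℝ) ^ 2 / 4) * θK) ^ 2))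
      ≤ θ / 64 := by
  have hL1 : (1 : ℝ) ≤ L := by exact_mod_cast hL
  have hL0 : (0 : ℝ) < L := by linarith
  -- `L^h ≥ L^j ≥ 6`
  have hLh : (6 : ℝ) ≤ (L : ℝ) ^ h := by
    rw [hh, pow_add]
    have h1m : (1 : ℝ) ≤ (L : ℝ) ^ m := one_le_pow₀ hL1
    nlinarith [mul_nonneg (sub_nonneg.2 hLj) (sub_nonneg.2 h1m)]
  have hpair := reading_pair_le_two_mul (L := L) hLh hθK0
  have hrow := reading_row_far_le' hL hθ hθx hθK0 hθK hx hh
  -- the weight `(L^j)²∕(L^h)² = (L^(2m))⁻¹`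
  have hratio : ((L : ℝ) ^ j) ^ 2 / ((L : ℝ) ^ h) ^ 2 = ((L : ℝ) ^ (2 * m))⁻¹ := by
    have e1 : ((L : ℝ) ^ h) ^ 2 = ((L : ℝ) ^ j) ^ 2 * (L : ℝ) ^ (2 * m) := by rw [hh]; ring
    have hLj0 : ((L : ℝ) ^ j) ^ 2 ≠ 0 := pow_ne_zero _ (pow_ne_zero _ hL0.ne')
    have hLm0 : (L : ℝ) ^ (2 * m) ≠ 0 := pow_ne_zero _ hL0.ne'
    rw [e1, div_mul_eq_div_div, div_self hLj0, one_div]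
  rw [hratio]
  have hw0 : 0 ≤ ((L : ℝ) ^ (2 * m))⁻¹ := by positivity
  have hmul := mul_le_mul_of_nonneg_left hpair hw0
  have hfac : 3062500 * Real.sqrt 3 * ((4 : ℝ) ^ p₀ * (400 : ℝ) ^ m * (L : ℝ) ^ (4 * m)) * (60400 : ℝ) ^ j / (L : ℝ) ^ (12 * j) * θ
      ≤ ε * θ := mul_le_mul_of_nonneg_right hfar hθ
  have hεθ : ε * θ ≤ 1 / 128 * θ := mul_le_mul_of_nonneg_right hε hθ
  have hre : ((L : ℝ) ^ (2 * m))⁻¹ * (2 * (100 * Real.sqrt 3 * (20 * (L : ℝ)) ^ (2 * h) * (175 * (L : ℝ) ^ (2 * h) * θK) ^ 2))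
      = 2 * (((L : ℝ) ^ (2 * m))⁻¹ * (100 * Real.sqrt 3 * (20 * (L : ℝ)) ^ (2 * h) * (175 * (L : ℝ) ^ (2 * h) * θK) ^ 2)) := by
    ring
  rw [hre] at hmul
  linarith

/-- ★ **CONJUNCT (3)** — the (P″) profile error, in the door's letters, IS px6's (η5) row `profile_error_row_le` (ring). [folklore] -/
theorem profile_conjunct_le (hL : 1 ≤ L) (hθ : 0 ≤ θ) (hθK : θK ≤ (2 : ℝ) ^ p₀ * Real.sqrt ((L : ℝ)⁻¹) ^ j * θ)
    {R A_S : ℝ} (hR : R = N_R * (L : ℝ) ^ (2 * j + h)) (hAS : 0 ≤ A_S) (hNRS : 1536 * Real.sqrt 3 * (2 : ℝ) ^ p₀ * A_S ≤ N_R)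
    (hNR : 1 ≤ N_R) :
    (Real.sqrt 3 * θK) * (A_S * (24 * (((L : ℝ) ^ j) ^ 2) * (L : ℝ) ^ h) / R) ≤ θ / 64 := by
  have hrow := profile_error_row_le hL hθ hθK hR hAS hNRS (by linarith)
  have hid : (Real.sqrt 3 * θK) * (A_S * (24 * (((L : ℝ) ^ j) ^ 2) * (L : ℝ) ^ h) / R)
      = 24 * Real.sqrt 3 * A_S * θK * (L : ℝ) ^ (2 * j + h) / R := by
    rw [pow_add, pow_mul, ← pow_mul, ← pow_mul, mul_comm j 2]
    ring
  rw [hid]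
  exact hrow

/-- ★ **CONJUNCT (4)** — the bulk (Bianchi-defect) error, in the door's letters at `d = 3` (`βK = (6R+7)²θK ≤ 49R²θK`, `R ≥ 12`), is
`≤ θ∕64` once the bulk FACTOR is `≤ ε ≤ 1∕128`. [folklore] -/
theorem bulk_conjunct_le (hL : 1 ≤ L) (hh : h = j + m) (hθ : 0 ≤ θ) (hθx : θ ≤ x) (hθK0 : 0 ≤ θK)
    (hθK : θK ≤ (2 : ℝ) ^ p₀ * Real.sqrt ((L : ℝ)⁻¹) ^ j * θ) (hx : x ≤ (151 * (L : ℝ) ^ 2 * ((L : ℝ)⁻¹) ^ 19) ^ j)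
    {R : ℕ} (hR12 : 12 ≤ R) (hNR : 1 ≤ N_R) (hR : (R : ℝ) = N_R * (L : ℝ) ^ (2 * j + h))
    {A_B A_B' : ℝ} (hAB : 0 ≤ A_B) (hAB' : 0 ≤ A_B') {ε : ℝ} (hε : ε ≤ 1 / 128)
    (hbulk : 1888 * Real.sqrt 3 * (A_B + A_B') * (N_R ^ 3 * (4 : ℝ) ^ p₀ * (L : ℝ) ^ (3 * m)) * (151 : ℝ) ^ j / (L : ℝ) ^ (7 * j) ≤ ε) :
    Real.sqrt 3 * (60 * θK ^ 2 + 6 * ((((2 * 3 * (2 * R + 2) + 2 : ℕ) : ℝ) ^ 2 / 4) * θK) * θK) / 3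
        * ((A_B + A_B' * (2 * (R : ℝ) + 2 * (L : ℝ) ^ h)) * (4 * ((L : ℝ) ^ j) ^ 2)) ≤ θ / 64 := by
  have hL1 : (1 : ℝ) ≤ L := by exact_mod_cast hL
  have h3 : 0 ≤ Real.sqrt 3 := Real.sqrt_nonneg 3
  have hR7 : (7 : ℝ) ≤ (R : ℝ) := by exact_mod_cast (le_trans (by norm_num) hR12)
  have hR0 : (0 : ℝ) ≤ (R : ℝ) := by linarith
  -- `βK ≤ 49R²θK`
  have hβK : (((2 * 3 * (2 * R + 2) + 2 : ℕ) : ℝ) ^ 2 / 4) * θK ≤ 49 * (R : ℝ) ^ 2 * θK := by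
    rw [betaK_prefactor_eq]
    exact mul_le_mul_of_nonneg_right (sq_six_mul_add_seven_le hR7) hθK0
  -- hence `ηΦ ≤ η_F` of the row
  have hη : Real.sqrt 3 * (60 * θK ^ 2 + 6 * ((((2 * 3 * (2 * R + 2) + 2 : ℕ) : ℝ) ^ 2 / 4) * θK) * θK) / 3
      ≤ Real.sqrt 3 * (60 * θK ^ 2 + 6 * (49 * (R : ℝ) ^ 2 * θK) * θK) / 3 := by
    have h6 : 6 * ((((2 * 3 * (2 * R + 2) + 2 : ℕ) : ℝ) ^ 2 / 4) * θK) * θK ≤ 6 * (49 * (R : ℝ) ^ 2 * θK) * θK := by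
      nlinarith
    have := mul_le_mul_of_nonneg_left (by linarith : 60 * θK ^ 2 + 6 * ((((2 * 3 * (2 * R + 2) + 2 : ℕ) : ℝ) ^ 2 / 4) * θK) * θK
        ≤ 60 * θK ^ 2 + 6 * (49 * (R : ℝ) ^ 2 * θK) * θK) h3
    linarith
  have hP0 : 0 ≤ (A_B + A_B' * (2 * (R : ℝ) + 2 * (L : ℝ) ^ h)) * (4 * ((L : ℝ) ^ j) ^ 2) := by positivity
  have hmono := mul_le_mul_of_nonneg_right hη hP0
  have hrow := bulk_row_le' hL hθ hθx hθK0 hθK hx hNR hh hR hAB hAB'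
  have hsq : ((L : ℝ) ^ j) ^ 2 = (L : ℝ) ^ (2 * j) := by rw [← pow_mul, mul_comm]
  have hre : Real.sqrt 3 * (60 * θK ^ 2 + 6 * (49 * (R : ℝ) ^ 2 * θK) * θK) / 3
        * ((A_B + A_B' * (2 * (R : ℝ) + 2 * (L : ℝ) ^ h)) * (4 * ((L : ℝ) ^ j) ^ 2))
      = Real.sqrt 3 * (60 * θK ^ 2 + 6 * (49 * (R : ℝ) ^ 2 * θK) * θK) / 3
        * (A_B + A_B' * (2 * (R : ℝ) + 2 * (L : ℝ) ^ h)) * (4 * (L : ℝ) ^ (2 * j)) := by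
    rw [hsq]; ring
  rw [hre] at hmono
  have hfac : 1888 * Real.sqrt 3 * (A_B + A_B') * (N_R ^ 3 * (4 : ℝ) ^ p₀ * (L : ℝ) ^ (3 * m)) * (151 : ℝ) ^ j / (L : ℝ) ^ (7 * j) * θ
      ≤ ε * θ := mul_le_mul_of_nonneg_right hbulk hθ
  have hεθ : ε * θ ≤ 1 / 128 * θ := mul_le_mul_of_nonneg_right hε hθ
  linarith

end Conjuncts

/-! ## §3 ★ The leaf: all four conjuncts of `hS7` -/

/-- ★ **THE (η)-SIGNAL LEAF (S7) OF THE B6 DOOR.**  In the door skeleton's letters (`d = 3`, `h = j + m`, `R = N_R·L^{2j+h}` with `R ≥ 12`,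
`L^j ≥ 6`), under the threshold ratio `θK ≤ 2^{p₀}√(L⁻¹)^j·θ`, the CAP `x ≤ (151L²L⁻¹⁹)^j`, `1536√3·2^{p₀}·A_S ≤ N_R`, and the three
FACTOR rows `≤ ε ≤ 1∕128` (the `∀ j > j₀` clause of ✓`exists_j0_door_nat`, conjuncts 3, 4, 1): the reading errors at height `j`, the
weighted reading errors at height `h`, the (P″) profile error and the bulk Bianchi-defect error are each `≤ θ∕64`. [folklore] -/
theorem signal_rows_le {L : ℕ} (hL : 1 ≤ L) {d : ℕ} (hd : d = 3) {j m h : ℕ} (hh : h = j + m) (hLj : (6 : ℝ) ≤ (L : ℝ) ^ j)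
    {θ θK x p₀ N_R A_S A_B A_B' ε : ℝ} {R : ℕ} (hR12 : 12 ≤ R)
    (hθ : 0 ≤ θ) (hθx : θ ≤ x) (hθK0 : 0 ≤ θK) (hθK : θK ≤ (2 : ℝ) ^ p₀ * Real.sqrt ((L : ℝ)⁻¹) ^ j * θ)
    (hx : x ≤ (151 * (L : ℝ) ^ 2 * ((L : ℝ)⁻¹) ^ 19) ^ j)
    (hNR : 1 ≤ N_R) (hNRS : 1536 * Real.sqrt 3 * (2 : ℝ) ^ p₀ * A_S ≤ N_R) (hR : (R : ℝ) = N_R * (L : ℝ) ^ (2 * j + h))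
    (hAS : 0 ≤ A_S) (hAB : 0 ≤ A_B) (hAB' : 0 ≤ A_B') (hε : ε ≤ 1 / 128)
    (hread : 3062500 * Real.sqrt 3 * ((4 : ℝ) ^ p₀ * 1) * (60400 : ℝ) ^ j / (L : ℝ) ^ (12 * j) ≤ ε)
    (hfar : 3062500 * Real.sqrt 3 * ((4 : ℝ) ^ p₀ * (400 : ℝ) ^ m * (L : ℝ) ^ (4 * m)) * (60400 : ℝ) ^ j / (L : ℝ) ^ (12 * j) ≤ ε)
    (hbulk : 1888 * Real.sqrt 3 * (A_B + A_B') * (N_R ^ 3 * (4 : ℝ) ^ p₀ * (L : ℝ) ^ (3 * m)) * (151 : ℝ) ^ j / (L : ℝ) ^ (7 * j) ≤ ε) :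
    Real.sqrt 3 * (13 * ((((2 * d * (4 * L ^ j + 2) + 2 : ℕ) : ℝ) ^ 2 / 4) * θK) ^ 2) * ((L : ℝ) ^ j) ^ 2
          + Real.sqrt 3 * (100 * ((4 * ((((d + 2) * L : ℕ) : ℝ))) ^ j) ^ 2 * ((((2 * d * (4 * L ^ j + 2) + 2 : ℕ) : ℝ) ^ 2 / 4) * θK) ^ 2)
        ≤ θ / 64 ∧
      (((L : ℝ) ^ j) ^ 2 / ((L : ℝ) ^ h) ^ 2) *
          (Real.sqrt 3 * (13 * ((((2 * d * (4 * L ^ h + 2) + 2 : ℕ) : ℝ) ^ 2 / 4) * θK) ^ 2) * ((L : ℝ) ^ h) ^ 2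
            + Real.sqrt 3 * (100 * ((4 * ((((d + 2) * L : ℕ) : ℝ))) ^ h) ^ 2 * ((((2 * d * (4 * L ^ h + 2) + 2 : ℕ) : ℝ) ^ 2 / 4) * θK) ^ 2))
        ≤ θ / 64 ∧
      (Real.sqrt 3 * θK) * (A_S * (24 * (((L : ℝ) ^ j) ^ 2) * (L : ℝ) ^ h) / (R : ℝ)) ≤ θ / 64 ∧
      Real.sqrt 3 * (60 * θK ^ 2 + 6 * ((((2 * d * (2 * R + 2) + 2 : ℕ) : ℝ) ^ 2 / 4) * θK) * θK) / 3
          * ((A_B + A_B' * (2 * (R : ℝ) + 2 * (L : ℝ) ^ h)) * (4 * ((L : ℝ) ^ j) ^ 2)) ≤ θ / 64 := by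
  subst hd
  exact ⟨reading_conjunct_le hL hLj hθ hθx hθK0 hθK hx hε hread,
    reading_far_conjunct_le hL hh hLj hθ hθx hθK0 hθK hx hε hfar,
    profile_conjunct_le hL hθ hθK hR hAS hNRS hNR,
    bulk_conjunct_le hL hh hθ hθx hθK0 hθK hx hR12 hNR hR hAB hAB' hε hbulk⟩

end Summit.QuantumFields.YangMills.Theorems.CovariantDischargeDoorSignalRows

end
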